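import Summits.Ventures.PercRepro.S2MaxExtensionTwoLevel

/-!
# PercRepro — S2: THE MAXIMAL-CLOSURE SPANNING `6`-SETS WITH ONE DISTINGUISHED FLAT, COUNTED (p7, gen 13; sub-claim S2; the cell `(14, 8)`)

S2MaxExtensionCount's assembly with the two-level bounds of S2MaxExtensionTwoLevel: **`card_spanMax_mul_six_le_two`** —
`6·#{S ∈ spanAll : |cl S| = f} ≤ s₃·(((n − 3)² − (n − 3))·e + (|G|² − |G|)·(E − e)) + s₄·3·((n − 4)·e + |G|·(E − e)) + s₅·6e + C(|G|, 5)·6(E − e) + 6s₆`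
(the `5`-circuits whose closure is `G` lie in `G`: at most `C(|G|, 5)` of them). Axioms: standard.
-/

open scoped Matroid

namespace PercRepro

namespace S2

open Set Finset

variable {α : Type} {M : Matroid α}

open scoped Classical in
/-- **THE MAXIMAL-CLOSURE SPANNING `6`-SETS WITH ONE DISTINGUISHED FLAT `G`, COUNTED.** -/
theorem card_spanMax_mul_six_le_two [M.Finite] (f e E : ℕ) (heE : e ≤ E) (hcirc : ∀ C, M.IsCircuit C → 3 ≤ C.encard)
    {G : Set α} (hGE : G ⊆ M.E)
    (hG : ({x ∈ M.E \ G | (M.closure (insert x G)).ncard = f}).ncard ≤ E)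
    (he : ∀ P ⊆ M.E, M.closure P = P → M.eRk P = 4 → 5 ≤ P.ncard → P ≠ G →
      ({x ∈ M.E \ P | (M.closure (insert x P)).ncard = f}).ncard ≤ e) :
    ((spanAll M 5).filter (fun S => (M.closure S).ncard = f)).card * 6 ≤
      {C | M.IsCircuit C ∧ C.ncard = 3}.ncard *
        (((M.E.ncard - 3) * (M.E.ncard - 3) - (M.E.ncard - 3)) * e + (G.ncard * G.ncard - G.ncard) * (E - e)) +
      {C | M.IsCircuit C ∧ C.ncard = 4}.ncard * (3 * ((M.E.ncard - 4) * e + G.ncard * (E - e))) +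
      {C | M.IsCircuit C ∧ C.ncard = 5}.ncard * (6 * e) + G.ncard.choose 5 * (6 * (E - e)) +
      {C | M.IsCircuit C ∧ C.ncard = 6}.ncard * 6 := by
  have hGfin : G.Finite := M.ground_finite.subset hGE
  have h0 := card_spanMax_le_sum (M := M) f hcirc
  have hI : Finset.Icc 3 6 = {3, 4, 5, 6} := by decide
  rw [hI, Finset.sum_insert (by decide), Finset.sum_insert (by decide), Finset.sum_insert (by decide),
    Finset.sum_singleton] at h0
  have h3 : ∑ C ∈ Matroid.circF M 3, ((Matroid.subsF (Matroid.groundF M) (6 - 3)).filter (fun B' => Disjoint B' C ∧ M.eRk (C ∪ B') = 5 ∧ (M.closure (C ∪ B')).ncard = f)).card * 6 ≤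
      {C | M.IsCircuit C ∧ C.ncard = 3}.ncard *
        (((M.E.ncard - 3) * (M.E.ncard - 3) - (M.E.ncard - 3)) * e + (G.ncard * G.ncard - G.ncard) * (E - e)) := by
    rw [← Matroid.card_circF, Finset.card_eq_sum_ones, Finset.sum_mul]
    refine Finset.sum_le_sum (fun C hC => ?_)
    rw [one_mul]
    obtain ⟨hC, hC3⟩ := Matroid.mem_circF.1 hC
    have hCE := hC.subset_ground
    have hr : M.eRk C = 2 := eRk_eq_of_isCircuit_ncard hC (by rw [hC3])
    have hEC : (M.E \ C).ncard = M.E.ncard - 3 := by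
      rw [Set.ncard_sdiff hCE (M.ground_finite.subset hCE), hC3]
    have := card_extMax_three_mul_le_two hCE hr hC3 f e E heE hGE hG he
    rw [hEC] at this
    exact this
  have h4 : ∑ C ∈ Matroid.circF M 4, ((Matroid.subsF (Matroid.groundF M) (6 - 4)).filter (fun B' => Disjoint B' C ∧ M.eRk (C ∪ B') = 5 ∧ (M.closure (C ∪ B')).ncard = f)).card * 6 ≤
      {C | M.IsCircuit C ∧ C.ncard = 4}.ncard * (3 * ((M.E.ncard - 4) * e + G.ncard * (E - e))) := by
    rw [← Matroid.card_circF, Finset.card_eq_sum_ones, Finset.sum_mul]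
    refine Finset.sum_le_sum (fun C hC => ?_)
    rw [one_mul]
    obtain ⟨hC, hC4⟩ := Matroid.mem_circF.1 hC
    have hCE := hC.subset_ground
    have hr : M.eRk C = 3 := eRk_eq_of_isCircuit_ncard hC (by rw [hC4])
    have hEC : (M.E \ C).ncard = M.E.ncard - 4 := by
      rw [Set.ncard_sdiff hCE (M.ground_finite.subset hCE), hC4]
    have := card_extMax_two_mul_le_two hCE hr (by omega) f e E heE hGE hG he
    rw [hEC] at this
    calc _ = ((Matroid.subsF (Matroid.groundF M) 2).filter (fun B' => Disjoint B' C ∧ M.eRk (C ∪ B') = 5 ∧ (M.closure (C ∪ B')).ncard = f)).card * 2 * 3 := by ring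
      _ ≤ ((M.E.ncard - 4) * e + G.ncard * (E - e)) * 3 := Nat.mul_le_mul_right 3 this
      _ = _ := by ring
  have h5 : ∑ C ∈ Matroid.circF M 5, ((Matroid.subsF (Matroid.groundF M) (6 - 5)).filter (fun B' => Disjoint B' C ∧ M.eRk (C ∪ B') = 5 ∧ (M.closure (C ∪ B')).ncard = f)).card * 6 ≤
      {C | M.IsCircuit C ∧ C.ncard = 5}.ncard * (6 * e) + G.ncard.choose 5 * (6 * (E - e)) := by
    -- split the `5`-circuits by whether their closure is `G`
    have hterm : ∀ C ∈ Matroid.circF M 5,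
        ((Matroid.subsF (Matroid.groundF M) (6 - 5)).filter (fun B' => Disjoint B' C ∧ M.eRk (C ∪ B') = 5 ∧ (M.closure (C ∪ B')).ncard = f)).card * 6 ≤
          6 * e + (if M.closure C = G then 6 * (E - e) else 0) := by
      intro C hC
      obtain ⟨hC, hC5⟩ := Matroid.mem_circF.1 hC
      have hCE := hC.subset_ground
      have hr : M.eRk C = 4 := eRk_eq_of_isCircuit_ncard hC (by rw [hC5])
      have h1 := card_extMax_one_le hr f
      have h5cl : 5 ≤ (M.closure C).ncard := by
        have := Set.ncard_le_ncard (M.subset_closure C hCE) (M.ground_finite.subset (M.closure_subset_ground C))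
        omega
      by_cases hCG : M.closure C = G
      · rw [if_pos hCG]
        rw [hCG] at h1
        calc _ ≤ E * 6 := Nat.mul_le_mul_right 6 (h1.trans hG)
          _ ≤ _ := by omega
      · rw [if_neg hCG, add_zero]
        have h2 := he _ (M.closure_subset_ground _) (M.closure_closure _) (by rw [M.eRk_closure_eq, hr]) h5cl hCG
        calc _ ≤ e * 6 := Nat.mul_le_mul_right 6 (h1.trans h2)
          _ = 6 * e := by ring
    refine (Finset.sum_le_sum hterm).trans ?_
    rw [Finset.sum_add_distrib, Finset.sum_const, smul_eq_mul, Finset.sum_ite, Finset.sum_const_zero, add_zero,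
      Finset.sum_const, smul_eq_mul, Matroid.card_circF]
    refine add_le_add le_rfl (Nat.mul_le_mul_right _ ?_)
    -- the `5`-circuits with closure `G` are `5`-subsets of `G`
    calc ((Matroid.circF M 5).filter (fun C => M.closure C = G)).card
        ≤ (Matroid.subsF hGfin.toFinset 5).card := by
          refine Finset.card_le_card ?_
          intro C hC
          rw [Finset.mem_filter, Matroid.mem_circF] at hC
          obtain ⟨⟨hC, hC5⟩, hCG⟩ := hC
          refine Matroid.mem_subsF_of ?_ hC5
          rw [Set.Finite.coe_toFinset, ← hCG]
          exact M.subset_closure C hC.subset_ground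
      _ ≤ hGfin.toFinset.card.choose 5 := Matroid.card_subsF_le _ _
      _ = G.ncard.choose 5 := by rw [← Set.ncard_eq_toFinset_card _ hGfin]
  have h6 : ∑ C ∈ Matroid.circF M 6, ((Matroid.subsF (Matroid.groundF M) (6 - 6)).filter (fun B' => Disjoint B' C ∧ M.eRk (C ∪ B') = 5 ∧ (M.closure (C ∪ B')).ncard = f)).card * 6 ≤
      {C | M.IsCircuit C ∧ C.ncard = 6}.ncard * 6 := by
    rw [← Matroid.card_circF, Finset.card_eq_sum_ones, Finset.sum_mul]
    refine Finset.sum_le_sum (fun C _ => ?_)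
    rw [one_mul]
    have h1 : ((Matroid.subsF (Matroid.groundF M) (6 - 6)).filter (fun B' => Disjoint B' C ∧ M.eRk (C ∪ B') = 5 ∧ (M.closure (C ∪ B')).ncard = f)).card ≤ 1 := by
      calc _ ≤ (Matroid.subsF (Matroid.groundF M) (6 - 6)).card := Finset.card_filter_le _ _
        _ ≤ (Matroid.groundF M).card.choose (6 - 6) := Matroid.card_subsF_le _ _
        _ = 1 := by simp
    calc _ ≤ 1 * 6 := Nat.mul_le_mul_right 6 h1
      _ = 6 := by norm_num
  calc ((spanAll M 5).filter (fun S => (M.closure S).ncard = f)).card * 6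
      ≤ (∑ C ∈ Matroid.circF M 3, ((Matroid.subsF (Matroid.groundF M) (6 - 3)).filter (fun B' => Disjoint B' C ∧ M.eRk (C ∪ B') = 5 ∧ (M.closure (C ∪ B')).ncard = f)).card +
          ∑ C ∈ Matroid.circF M 4, ((Matroid.subsF (Matroid.groundF M) (6 - 4)).filter (fun B' => Disjoint B' C ∧ M.eRk (C ∪ B') = 5 ∧ (M.closure (C ∪ B')).ncard = f)).card +
          ∑ C ∈ Matroid.circF M 5, ((Matroid.subsF (Matroid.groundF M) (6 - 5)).filter (fun B' => Disjoint B' C ∧ M.eRk (C ∪ B') = 5 ∧ (M.closure (C ∪ B')).ncard = f)).card +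
          ∑ C ∈ Matroid.circF M 6, ((Matroid.subsF (Matroid.groundF M) (6 - 6)).filter (fun B' => Disjoint B' C ∧ M.eRk (C ∪ B') = 5 ∧ (M.closure (C ∪ B')).ncard = f)).card) * 6 := by
        rw [← add_assoc, ← add_assoc] at h0
        exact Nat.mul_le_mul_right 6 h0
    _ = ∑ C ∈ Matroid.circF M 3, ((Matroid.subsF (Matroid.groundF M) (6 - 3)).filter (fun B' => Disjoint B' C ∧ M.eRk (C ∪ B') = 5 ∧ (M.closure (C ∪ B')).ncard = f)).card * 6 +
          ∑ C ∈ Matroid.circF M 4, ((Matroid.subsF (Matroid.groundF M) (6 - 4)).filter (fun B' => Disjoint B' C ∧ M.eRk (C ∪ B') = 5 ∧ (M.closure (C ∪ B')).ncard = f)).card * 6 +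
          ∑ C ∈ Matroid.circF M 5, ((Matroid.subsF (Matroid.groundF M) (6 - 5)).filter (fun B' => Disjoint B' C ∧ M.eRk (C ∪ B') = 5 ∧ (M.closure (C ∪ B')).ncard = f)).card * 6 +
          ∑ C ∈ Matroid.circF M 6, ((Matroid.subsF (Matroid.groundF M) (6 - 6)).filter (fun B' => Disjoint B' C ∧ M.eRk (C ∪ B') = 5 ∧ (M.closure (C ∪ B')).ncard = f)).card * 6 := by
        rw [← Finset.sum_mul, ← Finset.sum_mul, ← Finset.sum_mul, ← Finset.sum_mul]
        ring
    _ ≤ _ := by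
        have := add_le_add (add_le_add (add_le_add h3 h4) h5) h6
        linarith

end S2

end PercRepro
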